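import Mathlib.Analysis.Complex.Schwarz
import Mathlib.Analysis.Complex.RemovableSingularity
import Mathlib.Analysis.Complex.AbsMax
import Mathlib.Topology.Algebra.IsUniformGroup.Basic
import Literature.Analysis.Complex.RiemannMapping
import HarnessLib

/-!
# Near-identity self-maps of the disc, and a moving-target zero lemma

Topic `Literature/Analysis/Complex`; two elementary support lemmas for the convergence step of the
Koebe / Fisher–Hubbard–Wittner construction of the holomorphic universal covering of a plane domain
(programme «UNIF-G1P» of the abc-iut cell; Y. Fisher, J. H. Hubbard, B. S. Wittner, PAMS 104 (1988)
413–418, Part c pp. 415–417), in the Ũ-free form used by the tree (maps from the disc with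
derivatives normalised POSITIVE at `0`, FHW Remark (2) p. 417 «We can make the `f_n` and `π_n`
converge (not just via a subsequence) by normalizing their derivatives to be positive»):

* `Complex.norm_sub_self_le_of_deriv_zero_real` — **near-identity Schwarz–Pick estimate**: a
  holomorphic `h : 𝔻 → 𝔻` with `h 0 = 0` and `h′(0) = t > 0` real satisfies
  `‖h z − z‖ ≤ ‖z‖²(1 − t²)/(1 − ‖z‖) + (1 − t)‖z‖`; hence `h_n → id` locally uniformly on `𝔻` as
  soon as `h_n′(0) ↑ 1`, WITHOUT extracting subsequences (the Schwarz lemma applied to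
  `φ_t ∘ (h z / z)`);
* `Complex.eventually_exists_mem_ball_apply_eq` — **moving-target zero lemma**: if `h_n → id`
  locally uniformly on an open set `U` (holomorphic `h_n`) and `w_n → w⋆ ∈ U`, then for every small
  `s > 0` eventually `w_n = h_n y` for some `y ∈ ball w⋆ s` (Hurwitz's theorem, tree
  `Complex.eventually_exists_zero_mem_ball_of_tendstoUniformlyOn`, applied to `h_n − w_n → z − w⋆`);
  this is the input «`{f_{n_i}^{-1}(w)}` is a sequence […] with a limit point `v` such that
  `f(v) = w`» of FHW Lemma 3.3 (p. 417).

Proof-only; no definition.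

## References
* Y. Fisher, J. H. Hubbard, B. S. Wittner, PAMS 104 (1988) 413–418, Lemma 3.3 and Remark (2)
  p. 417. [FisherHubbardWittner1988]
* J. B. Conway, *Functions of One Complex Variable I* (1978), Ch. VI Lemma 2.1 (Schwarz),
  Prop. 2.2; Ch. VII Thm. 2.5 (Hurwitz). [Conway1978]
-/

noncomputable section

open Filter Metric Set Topology Function
open scoped ComplexConjugate

namespace Complex

/-! ### The near-identity estimate -/

/-- **Near-identity Schwarz–Pick estimate** (from the Schwarz lemma, Conway VI.2.1, applied to
`φ_t ∘ (h z / z)`; FHW 1988 Remark (2) p. 417, positivity normalisation): if `h` is holomorphic on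
the unit disc, maps it into itself, `h 0 = 0` and `h′(0) = t` is a POSITIVE REAL number, then for
`‖z‖ < 1`, `‖h z − z‖ ≤ ‖z‖² (1 − t²)/(1 − ‖z‖) + (1 − t)‖z‖`.  In particular the right-hand side
tends to `0`, uniformly on compact subsets of the disc, as `t → 1`.
[cite: FisherHubbardWittner1988, Remark (2) p.417] -/
theorem norm_sub_self_le_of_deriv_zero_real {h : ℂ → ℂ} (hd : DifferentiableOn ℂ h (ball 0 1))
    (hmaps : MapsTo h (ball 0 1) (ball 0 1)) (h0 : h 0 = 0) {t : ℝ} (ht : deriv h 0 = t)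
    (ht0 : 0 < t) {z : ℂ} (hz : ‖z‖ < 1) :
    ‖h z - z‖ ≤ ‖z‖ ^ 2 * (1 - t ^ 2) / (1 - ‖z‖) + (1 - t) * ‖z‖ := by
  -- the function `g = h z / z` (`dslope h 0`), bounded by `1` on the disc (Schwarz)
  set g : ℂ → ℂ := dslope h 0 with hg
  have hball : ball (0 : ℂ) 1 ∈ 𝓝 (0 : ℂ) := isOpen_ball.mem_nhds (mem_ball_self one_pos)
  have hgd : DifferentiableOn ℂ g (ball 0 1) := (differentiableOn_dslope hball).2 hd
  have hmaps' : MapsTo h (ball 0 1) (closedBall (h 0) 1) := by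
    rw [h0]; exact fun z hz ↦ ball_subset_closedBall (hmaps hz)
  have hg1 : ∀ w ∈ ball (0 : ℂ) 1, ‖g w‖ ≤ 1 := fun w hw ↦ by
    simpa using norm_dslope_le_div_of_mapsTo_ball hd hmaps' hw
  have hg0 : g 0 = t := by rw [hg, dslope_same, ht]
  have ht1 : t ≤ 1 := by
    have := hg1 0 (mem_ball_self one_pos)
    rwa [hg0, Complex.norm_real, Real.norm_of_nonneg ht0.le] at this
  -- `h z = z * g z`
  have hhz : h z = z * g z := by
    by_cases hz0 : z = 0
    · rw [hz0, h0, zero_mul]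
    · rw [hg, dslope_of_ne _ hz0, slope, h0, vsub_eq_sub, sub_zero, sub_zero, smul_eq_mul,
        mul_inv_cancel_left₀ hz0]
  have hz1 : 0 < 1 - ‖z‖ := sub_pos.2 hz
  -- the key estimate `‖g z - t‖ ≤ ‖z‖ (1 - t²) / (1 - ‖z‖)`
  have hkey : ‖g z - t‖ ≤ ‖z‖ * (1 - t ^ 2) / (1 - ‖z‖) := by
    by_cases hmax : ∃ w ∈ ball (0 : ℂ) 1, ‖g w‖ = 1
    · -- `‖g‖` attains its maximum inside: `g` is constant, `t = 1`, `g z = t`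
      obtain ⟨w, hw, hw1⟩ := hmax
      have hM : IsMaxOn (norm ∘ g) (ball 0 1) w := fun v hv ↦ by
        simpa [hw1] using hg1 v hv
      have hconst := eqOn_of_isPreconnected_of_isMaxOn_norm (convex_ball (0 : ℂ) 1).isPreconnected
        isOpen_ball hgd hw hM
      have h1 : g z = g 0 :=
        (hconst (mem_ball_zero_iff.2 hz)).trans (hconst (mem_ball_self one_pos)).symm
      rw [h1, hg0, sub_self, norm_zero]
      exact div_nonneg (mul_nonneg (norm_nonneg _) (by nlinarith)) hz1.le
    · push Not at hmax
      have hglt : ∀ w ∈ ball (0 : ℂ) 1, ‖g w‖ < 1 := fun w hw ↦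
        lt_of_le_of_ne (hg1 w hw) (hmax w hw)
      have ht1' : t < 1 := by
        have := hglt 0 (mem_ball_self one_pos)
        rwa [hg0, Complex.norm_real, Real.norm_of_nonneg ht0.le] at this
      have htn : ‖(t : ℂ)‖ < 1 := by rwa [Complex.norm_real, Real.norm_of_nonneg ht0.le]
      -- Schwarz for `G = φ_t ∘ g`, `G 0 = 0`
      set G : ℂ → ℂ := discMobius t ∘ g with hG
      have hGd : DifferentiableOn ℂ G (ball 0 1) :=
        (differentiableOn_discMobius htn).comp hgd (fun w hw ↦ mem_ball_zero_iff.2 (hglt w hw))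
      have hGmaps : MapsTo G (ball 0 1) (closedBall 0 1) := fun w hw ↦
        ball_subset_closedBall (mapsTo_discMobius htn (mem_ball_zero_iff.2 (hglt w hw)))
      have hG0 : G 0 = 0 := by
        show discMobius t (g 0) = 0
        rw [hg0, discMobius_self]
      have hS : ‖G z‖ ≤ ‖z‖ := norm_le_norm_of_mapsTo_ball hGd hGmaps hG0 hz
      -- unfold `G z = (g z - t) / (1 - t * g z)`
      have hden : 1 - conj (t : ℂ) * g z ≠ 0 :=
        one_sub_conj_mul_ne_zero htn (hglt z (mem_ball_zero_iff.2 hz)).le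
      have hGz : G z = (g z - t) / (1 - (t : ℂ) * g z) := by
        show discMobius t (g z) = _
        rw [discMobius_apply, Complex.conj_ofReal]
      rw [Complex.conj_ofReal] at hden
      rw [hGz, norm_div, div_le_iff₀ (norm_pos_iff.2 hden)] at hS
      -- `1 - t g = (1 - t²) + t (t - g)`
      have hsplit : (1 : ℂ) - (t : ℂ) * g z = ((1 - t ^ 2 : ℝ) : ℂ) + (t : ℂ) * ((t : ℂ) - g z) := by
        push_cast; ring
      have hn2 : ‖(1 : ℂ) - (t : ℂ) * g z‖ ≤ (1 - t ^ 2) + t * ‖g z - t‖ := by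
        rw [hsplit]
        refine (norm_add_le _ _).trans ?_
        rw [Complex.norm_real, Real.norm_of_nonneg (by nlinarith), norm_mul, Complex.norm_real,
          Real.norm_of_nonneg ht0.le, norm_sub_rev]
      have h3 : ‖g z - t‖ * (1 - ‖z‖ * t) ≤ ‖z‖ * (1 - t ^ 2) := by
        nlinarith [hS, hn2, norm_nonneg z, norm_nonneg (g z - t), mul_nonneg (norm_nonneg z) ht0.le]
      have h4 : 1 - ‖z‖ ≤ 1 - ‖z‖ * t := by nlinarith [norm_nonneg z]
      rw [le_div_iff₀ hz1]
      calc ‖g z - ↑t‖ * (1 - ‖z‖) ≤ ‖g z - ↑t‖ * (1 - ‖z‖ * t) :=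
            mul_le_mul_of_nonneg_left h4 (norm_nonneg _)
        _ ≤ ‖z‖ * (1 - t ^ 2) := h3
  -- conclusion
  have hsplit : h z - z = z * (g z - t) + ((t : ℂ) - 1) * z := by rw [hhz]; ring
  calc ‖h z - z‖ = ‖z * (g z - t) + ((t : ℂ) - 1) * z‖ := by rw [hsplit]
    _ ≤ ‖z * (g z - t)‖ + ‖((t : ℂ) - 1) * z‖ := norm_add_le _ _
    _ = ‖z‖ * ‖g z - t‖ + (1 - t) * ‖z‖ := by
        rw [norm_mul, norm_mul, show ((t : ℂ) - 1) = ((t - 1 : ℝ) : ℂ) by push_cast; ring,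
          Complex.norm_real, Real.norm_of_nonpos (by linarith)]
        ring
    _ ≤ ‖z‖ * (‖z‖ * (1 - t ^ 2) / (1 - ‖z‖)) + (1 - t) * ‖z‖ := by
        gcongr
    _ = ‖z‖ ^ 2 * (1 - t ^ 2) / (1 - ‖z‖) + (1 - t) * ‖z‖ := by ring

/-- Uniform form on a smaller disc: under the same hypotheses, `‖h z − z‖ ≤ r²(1 − t²)/(1 − r) + (1 − t) r`
for all `‖z‖ ≤ r < 1`. [cite: FisherHubbardWittner1988, Remark (2) p.417] -/
theorem norm_sub_self_le_of_deriv_zero_real_of_norm_le {h : ℂ → ℂ}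
    (hd : DifferentiableOn ℂ h (ball 0 1)) (hmaps : MapsTo h (ball 0 1) (ball 0 1)) (h0 : h 0 = 0)
    {t : ℝ} (ht : deriv h 0 = t) (ht0 : 0 < t) {r : ℝ} (hr : r < 1) {z : ℂ} (hz : ‖z‖ ≤ r) :
    ‖h z - z‖ ≤ r ^ 2 * (1 - t ^ 2) / (1 - r) + (1 - t) * r := by
  have hz1 : ‖z‖ < 1 := lt_of_le_of_lt hz hr
  have ht1 : t ≤ 1 := by
    have hmaps' : MapsTo h (ball 0 1) (closedBall (h 0) 1) := by
      rw [h0]; exact fun z hz ↦ ball_subset_closedBall (hmaps hz)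
    have := norm_deriv_le_div_of_mapsTo_ball hd hmaps' one_pos
    rw [ht, Complex.norm_real, Real.norm_of_nonneg ht0.le] at this
    linarith
  refine (norm_sub_self_le_of_deriv_zero_real hd hmaps h0 ht ht0 hz1).trans ?_
  have h1 : 0 ≤ 1 - t ^ 2 := by nlinarith
  have h2 : 0 < 1 - r := by linarith
  have h3 : 0 < 1 - ‖z‖ := by linarith
  have h4 : ‖z‖ ^ 2 * (1 - t ^ 2) / (1 - ‖z‖) ≤ r ^ 2 * (1 - t ^ 2) / (1 - r) := by
    rw [div_le_div_iff₀ h3 h2]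
    have : ‖z‖ ^ 2 * (1 - r) ≤ r ^ 2 * (1 - ‖z‖) := by
      nlinarith [norm_nonneg z, mul_nonneg (norm_nonneg z) (sub_nonneg.2 hz)]
    nlinarith
  have h5 : (1 - t) * ‖z‖ ≤ (1 - t) * r := mul_le_mul_of_nonneg_left hz (by linarith)
  linarith

/-! ### The moving-target zero lemma -/

/-- **Moving-target zero lemma** (Hurwitz; the input of FHW Lemma 3.3 p. 417).  Let `U` be open,
`h_n` holomorphic on `U` with `h_n → id` locally uniformly on `U` (along a non-trivial filter),
and `w_n → w⋆ ∈ U`.  Then for every `s > 0` with `closedBall w⋆ s ⊆ U`, eventually the value `w_n`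
is attained by `h_n` in `ball w⋆ s`. [cite: FisherHubbardWittner1988, Lemma 3.3 p.417] -/
theorem eventually_exists_mem_ball_apply_eq {ι : Type*} {l : Filter ι} [l.NeBot] {U : Set ℂ}
    (hU : IsOpen U) {h : ι → ℂ → ℂ} (hd : ∀ᶠ n in l, DifferentiableOn ℂ (h n) U)
    (hlim : TendstoLocallyUniformlyOn h id l U) {w : ι → ℂ} {wstar : ℂ}
    (hw : Tendsto w l (𝓝 wstar)) {s : ℝ} (hs : 0 < s) (hsU : closedBall wstar s ⊆ U) :
    ∀ᶠ n in l, ∃ y ∈ ball wstar s, h n y = w n := by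
  -- `F n z = h n z - w n → z - w⋆` uniformly on the closed disc
  have hunif : TendstoUniformlyOn h id l (closedBall wstar s) :=
    (tendstoLocallyUniformlyOn_iff_forall_isCompact hU).1 hlim _ hsU (isCompact_closedBall _ _)
  have hconst : TendstoUniformlyOn (fun n (_ : ℂ) ↦ w n) (fun _ ↦ wstar) l (closedBall wstar s) :=
    hw.tendstoUniformlyOn_const _
  have hF : TendstoUniformlyOn (fun n z ↦ h n z - w n) (fun z ↦ z - wstar) l (closedBall wstar s) :=
    hunif.sub hconst
  have hF' : ∀ᶠ n in l, DiffContOnCl ℂ (fun z ↦ h n z - w n) (ball wstar s) := by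
    filter_upwards [hd] with n hn using (hn.sub_const (w n)).diffContOnCl_ball hsU
  have hev := eventually_exists_zero_mem_ball_of_tendstoUniformlyOn hs hF' hF
    ((continuousOn_id.sub continuousOn_const)) (sub_self wstar) (fun z hz h0 ↦ by
      rw [mem_sphere_iff_norm, sub_eq_zero.1 h0, sub_self, norm_zero] at hz
      exact hs.ne' hz.symm)
  filter_upwards [hev] with n ⟨y, hy, hy0⟩
  exact ⟨y, hy, sub_eq_zero.1 hy0⟩

end Complex

end
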